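import Literature.MathematicalPhysics.QuantumFieldTheory.Balaban1983to89.B9Ineq3137LocalSup
import Literature.MathematicalPhysics.QuantumFieldTheory.Balaban1983to89.B9Eq315QTorus

/-!
# T. Bałaban, *Averaging operations for lattice gauge theories*, Commun. Math. Phys. **98** (1985) 17–51 [Balaban1985Averaging] (136) p. 39, p. 24
# (after (43)) *«this definition is local in the sense that Ū^k_c, c ⊂ Ω^{(k)}, depends only on the bond variables U_b for b ⊂ B^k(c₋) ∪ B^k(c₊)»*,
# p. 34 *«an analytic function of the variables A_b, b ⊂ B(c₋) ∪ B(c₊)»*, read against [Balaban1985BackgroundPropagators] (3.134)–(3.137) pp. 422–423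
# and (3.15) p. 393: **THE SECOND-ORDER TERM `C_k⁽²⁾(U₀, B)(c)` IS LOCAL IN THE FIELD `B` AND FACTORS THROUGH THE CHART `𝔸^S` OF THE BOX OF `c` —
# FOR EVERY FIELD `B`, IN PARTICULAR FOR THE PERIODIC EXTENSION OF A TORUS FIELD** (brick (R2) of row (D4)'s road to Bałaban's `Δ⁽²⁾(U)` at the
# tower, memo §25 (iv); «Y16», row (D4) OWNER lineage, gen 114)

CITATION HEADER (lean-in-tree rule 2026-08-18).  Audit cell `pub-balaban`, BINDER row (D4) (`RemainderConst` leaves for Bałaban's split), OWNER lineage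
`b2b-balaban-beta-an4`, gen 114.  [Balaban1985Averaging] (B7 = [4]; held `paper:balaban1985-cmp98-averaging`, journal page = PDF page + 16) (136)–(137)
p. 39, p. 24 (after (43)), p. 31 (after (91)), p. 34 (the sentence after (109)), (150) p. 40 — as quoted in `B7Eq136SecondOrder`, `B7LocalityGeneral`,
`B9Ineq3137LocalSup` (their authors' first-hand reads; this seat re-read [5] pp. 422–423 this generation); [Balaban1985BackgroundPropagators] (B9 = [5];
`paper:balaban1985-cmp99-background-propagators`, journal page = PDF page + 388) (3.15) p. 393 (the torus ∕ periodic extension `perCfg`), (3.134)–(3.137)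
pp. 422–423.  Composed BY NAME: lit-balaban r06's `B9Ineq3137LocalSup.CCovIter_congr` (locality of the remainder `C_j` in the pair (background, field)
on the box), p06's `B7Eq136SecondOrder.CCovIter2` (the definition `½(d²∕dt²)C_j(U₀, tB)(c)|₀`), b07∕p06's `B7Prop5Flat.agreeOn_insCfg_restr`,
`B12Ineq417Flat.boxBonds`.  Nothing of print is asserted here.

WHY THIS FILE («Y16»).  Row (D4)'s NODE D at the origin displays ONE analytic letter: print's (3.137) sentence for Bałaban's `Δ⁽²⁾(U)` («Y13a∕b∕c»,
this gen).  (3.134)∕(3.136) build `Δ⁽²⁾` from the second-order term `C⁽²⁾` of the averaging ([4] (136)) and the coefficients `(H\*J)(b)` (budget: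
«Y14», this gen).  On NE9's tower the averaging acts on the PERIODIC EXTENSION `perCfg` of the torus field ([5] (3.15); `B9Eq315QTorus.QtorusAt` =
`L⁻¹·linQcov (perCfg U) (perCfg A) (cornerSite c)`), so the torus second-order term is `C_k⁽²⁾(perCfg U, perCfg A)(c)` — a value of p06's
`CCovIter2` at a field which is NOT of the inserted form `ins_S a` that p06's (149)-bounds (`ineq149_secondOrder`) and r06's local form
(`ineq149_secondOrder_local`) speak about.  THIS FILE closes that gap once and for all:
* §1 **`CCovIter2_congr`** — `C_j⁽²⁾(U₀, B)(c) = C_j⁽²⁾(U₀′, B′)(c)` whenever `(U₀, B)` and `(U₀′, B′)` agree on the bonds of the box `B^j(c₋) ∪ B^j(c₊)`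
  (r06's `CCovIter_congr` under the slice `t ↦ tB`: the two slices agree for every `t`, so do their second `t`-derivatives at `0`);
* §2 **`CCovIter2_eq_chart`** — THE CHART: `C_j⁽²⁾(U₀, B)(c) = C_j⁽²⁾(U₀, ins_S(B|_S))(c)`, `S = boxBonds L j z κ` — for EVERY field `B` on `ℤ^d`
  (the mirror of b07's `B7LocalityGeneral.logCovIter_eq_chart` for the second-order term);
* §3 **`CCovIter2_perCfg_eq_chart`** — in particular for the periodic extensions of a torus background `U` and a torus field `A`
  (`B9Eq315QTorus.perCfg`): `C_j⁽²⁾(perCfg U, perCfg A)(c) = C_j⁽²⁾(perCfg U, ins_S((perCfg A)|_S))(c)`, and **`CCovIter2_perCfg_congr`** — two torus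
  fields whose periodic extensions agree on the box give the same value: the torus second-order term READS `A` ON THE BLOCKS OF `c` ONLY (the
  range clause `r_D` of the (3.137) display).
So p06's ∕ r06's (149)-inequalities for `C_j⁽²⁾` on inserted variables APPLY VERBATIM to the torus second-order term, at the inserted point
`a := (perCfg A)|_S`.

HONEST SCOPE.  [folklore] bookkeeping (a `congr` under `iteratedDeriv`, one `rw`); NO estimate of [4] or [5] is proved here; (149) ∕ (3.137) are NOT
applied here (that is the assembly step (R4) of memo §25 (iv), with «Y14»'s budget and the dualising map `B11Eq98V0primeCurrentSlots.rieszτ`);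
Bałaban's `Δ⁽²⁾(U)` is NOT constructed here.  Row (D4) class UNCHANGED (instance 0∕1; critical-path width 0 = NODE O; D4 DISCHARGE NO DATE); NOT B12
Thm 2, NOT BetaPertH, NOT continuum, NOT Clay.  HONEST DEPENDENCY (cell line): continuum YM on T⁴ ⇐ BetaPertH ∧ nine spine estimates (0/9 proved);
BetaPertH ⇐ (D1) ∧ (D4) ∧ CAP+tail; G-an2-4 gates asym, D1 and NE2/3/4.  NEW file; nothing modified; 0 `def`; standard axioms; no `sorry`.
Net new unproved facts: 0.
-/

noncomputable section

open scoped BigOperators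

namespace Literature.MathematicalPhysics.QuantumFieldTheory.Balaban1983to89.Beta.RemainderSecondOrderChart

open B7Prop1Local (AgreeOn InBox loK bondHiK)
open B7Prop3Flat (insCfg)
open B7Prop5Flat (restr agreeOn_insCfg_restr)
open B7Prop5GeneralInduction (CCovIter)
open B7Eq136SecondOrder (CCovIter2)
open B9Ineq3137LocalSup (CCovIter_congr)
open B12Ineq417Flat (boxBonds)

variable {d : ℕ} {𝔸 : Type*} [NormedRing 𝔸] [NormedAlgebra ℂ 𝔸] [CompleteSpace 𝔸]

/-! ## §1  Locality of the second-order term in the pair (background, field) -/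

/-- **LOCALITY OF `C_j⁽²⁾(U₀, B)(c)`** — it depends only on the bond variables of `U₀` AND of `B` in the box `B^j(c₋) ∪ B^j(c₊)` of the coarse bond
`c = (z, κ)`: r06's `CCovIter_congr` ([4] p. 24 ∕ p. 31 ∕ (150)) applied to the slices `t ↦ C_j(U₀, tB)(c)` (which agree for every `t ∈ ℂ`), under
the second `t`-derivative at `0` defining `C_j⁽²⁾` ((136)–(137)). [cite: Balaban1985Averaging, (136)–(137) p.39, p.24 (after (43)), p.31 (after (91)), (150) p.40] -/
theorem CCovIter2_congr (L : ℕ) (hL : 1 ≤ L) (j : ℕ) {U₀ U₀' : B7Prop1Explicit.Site d → Fin d → 𝔸ˣ}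
    {B B' : B7Prop1Explicit.Site d → Fin d → 𝔸} (z : B7Prop1Explicit.Site d) (κ : Fin d)
    (h₀ : AgreeOn (loK L j z) (bondHiK L j z κ) U₀ U₀') (h : AgreeOn (loK L j z) (bondHiK L j z κ) B B') :
    CCovIter2 L U₀ B j z κ = CCovIter2 L U₀' B' j z κ := by
  have hslice : (fun t : ℂ => CCovIter L U₀ (t • B) j z κ) = fun t : ℂ => CCovIter L U₀' (t • B') j z κ := by
    funext t
    exact CCovIter_congr L hL j z κ h₀ fun x μ hx hxe => by
      show t • B x μ = t • B' x μ
      rw [h x μ hx hxe]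
  rw [B7Eq136SecondOrder.CCovIter2_def, B7Eq136SecondOrder.CCovIter2_def, hslice]

/-! ## §2  The chart: `C_j⁽²⁾(U₀, ·)(c)` factors through the finitely many variables of the box -/

/-- **THE CHART OF THE SECOND-ORDER TERM AT ANY BACKGROUND AND ANY FIELD**: `C_j⁽²⁾(U₀, B)(c) = C_j⁽²⁾(U₀, ins_S(B|_S))(c)` with `S = boxBonds L j z κ`
the bonds of `B^j(c₋) ∪ B^j(c₊)` — `C_j⁽²⁾(U₀, ·)(c)` is a function of the variables `A_b, b ⊂ B(c₋) ∪ B(c₊)` (p. 34), so p06's (149)-bounds on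
inserted variables (`B7Eq136SecondOrder.ineq149_secondOrder`, r06's `ineq149_secondOrder_local`) apply to EVERY field at the inserted point `B|_S`.
[cite: Balaban1985Averaging, p.34, (136) p.39, p.24 (after (43))] -/
theorem CCovIter2_eq_chart (L : ℕ) (hL : 1 ≤ L) (U₀ : B7Prop1Explicit.Site d → Fin d → 𝔸ˣ)
    (B : B7Prop1Explicit.Site d → Fin d → 𝔸) (j : ℕ) (z : B7Prop1Explicit.Site d) (κ : Fin d) :
    CCovIter2 L U₀ B j z κ = CCovIter2 L U₀ (insCfg (boxBonds L j z κ) (restr (boxBonds L j z κ) B)) j z κ :=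
  CCovIter2_congr L hL j z κ (fun _ _ _ _ => rfl) (agreeOn_insCfg_restr (loK L j z) (bondHiK L j z κ) B)

/-! ## §3  The torus: periodic extensions -/

section Torus

open B9Eq315QTorus (perCfg perCfg_apply)

variable (P : Fin d → ℕ) [∀ i, NeZero (P i)]

/-- **THE TORUS SECOND-ORDER TERM FACTORS THROUGH THE CHART**: for a torus background `U` and a torus field `A` read on `ℤ^d` through their periodic
extensions ([5] (3.15)), `C_j⁽²⁾(perCfg U, perCfg A)(c) = C_j⁽²⁾(perCfg U, ins_S((perCfg A)|_S))(c)`, `S = boxBonds L j z κ` — the (149)-bounds on the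
chart apply to the torus term. [cite: Balaban1985BackgroundPropagators, (3.15) p.393, (3.136)–(3.137) pp.422–423] [cite: Balaban1985Averaging, p.34, (136) p.39] -/
theorem CCovIter2_perCfg_eq_chart (L : ℕ) (hL : 1 ≤ L) (U : B9SectCLatticeCarrier.Bond d P → 𝔸ˣ)
    (A : B9SectCLatticeCarrier.Bond d P → 𝔸) (j : ℕ) (z : B7Prop1Explicit.Site d) (κ : Fin d) :
    CCovIter2 L (perCfg P U) (perCfg P A) j z κ =
      CCovIter2 L (perCfg P U) (insCfg (boxBonds L j z κ) (restr (boxBonds L j z κ) (perCfg P A))) j z κ :=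
  CCovIter2_eq_chart L hL (perCfg P U) (perCfg P A) j z κ

/-- **THE TORUS SECOND-ORDER TERM READS THE FIELD ON THE BLOCKS OF `c` ONLY**: if the periodic extensions of two torus fields `A, A′` agree on the
bonds of the box `B^j(c₋) ∪ B^j(c₊)`, then `C_j⁽²⁾(perCfg U, perCfg A)(c) = C_j⁽²⁾(perCfg U, perCfg A′)(c)` — the finite range `r_D` of the (3.137)
display. [cite: Balaban1985BackgroundPropagators, (3.137) p.423, (3.15) p.393] [cite: Balaban1985Averaging, p.24 (after (43)), (136) p.39] -/
theorem CCovIter2_perCfg_congr (L : ℕ) (hL : 1 ≤ L) (U : B9SectCLatticeCarrier.Bond d P → 𝔸ˣ)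
    {A A' : B9SectCLatticeCarrier.Bond d P → 𝔸} (j : ℕ) (z : B7Prop1Explicit.Site d) (κ : Fin d)
    (h : AgreeOn (loK L j z) (bondHiK L j z κ) (perCfg P A) (perCfg P A')) :
    CCovIter2 L (perCfg P U) (perCfg P A) j z κ = CCovIter2 L (perCfg P U) (perCfg P A') j z κ :=
  CCovIter2_congr L hL j z κ (fun _ _ _ _ => rfl) h

end Torus

end Literature.MathematicalPhysics.QuantumFieldTheory.Balaban1983to89.Beta.RemainderSecondOrderChart

end
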